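import Literature.AlgebraicGeometry.Resolution.DefectlessDescentBase
import Mathlib.FieldTheory.AlgebraicClosure
import HarnessLib

/-!
# Descent of defectlessness (Kuhlmann 2010, Cor. 2.25), limit step: from `K̃·F` down to `F·N`

Topic: `Literature/AlgebraicGeometry/Resolution` (valued function fields). Second half of the
finite-level proof of the named fact `Kuhlmann2010DefectlessDescent`
(`GeneralizedStabilityTrdegOne.lean`) = F.-V. Kuhlmann, *Elimination of ramification I*, Trans.
AMS 362 (2010) = arXiv:1003.5678, **Cor. 2.25**. Setting: `K → F → Ω`, `Ω` algebraically closed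
and algebraic over `F`, `V` a valuation ring of `Ω`, `K̃ ⊆ Ω` the algebraic closure of `K`,
`M = K̃·F = F(K̃) ⊆ Ω` the compositum, `L = F(roots of r) ⊆ Ω` a finite normal extension of `F`
(`r ∈ F[X]`). We PROVE:

> if `(M, V ∩ M)` is a defectless field, then for some finite normal `N = K(roots of p)` of `K`,
> with `F₁ = F·N = F(roots of p)` and `L₁ = L·F₁ = F₁(roots of r)`, the valued field
> `(F₁, V ∩ F₁)` is defectless in `L₁`.

This is the finite-level form of the last step of the printed proof of Cor. 2.25 ("We will prove
that every finite subextension `E|F^h` of `(K̃.F)^h|F^h` is defectless. Since `((K̃.F)^h,v)` is a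
defectless field, it will then follow from Lemma 2.3 of [K6] that `(F^h,v)` is a defectless
field"): `M = ⋃_N F·N` over the finite normal subextensions `N` of `K̃/K`, and the invariants of
`L·M / M` are attained at a finite level. Precisely, `L·M / M` is finite normal and `M` is
defectless in it, so `[L·M : M] = g·e·f (L·M/M)` at `V` (all extensions are conjugate,
`ValuationConjugacy.lean`); choosing `N` so large that `F₁ = F·N` and `L₁ = L·F₁` contain: the
coefficients of an `F`-basis of `L` in an `M`-basis of `L·M` (so `[L₁ : F₁] ≤ [L·M : M]`), elements
separating the extensions of `V ∩ M` to `L·M` (so `g(L₁/F₁) ≥ g(L·M/M)`), elements of `L·M`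
representing `v(L·M)/vM` (so `e(L₁/F₁) ≥ e(L·M/M)`) and lifts of an `Mv`-basis of `(L·M)v` (so
`f(L₁/F₁) ≥ f(L·M/M)`), one gets
`g e f (L₁/F₁) ≥ g e f (L·M/M) = [L·M : M] ≥ [L₁ : F₁] ≥ g e f (L₁/F₁)` (fundamental inequality).

## Content (everything PROVED)

* `exists_finset_subset_mem_adjoin`, `mem_adjoin_adjoin_of_subset`,
  `exists_polynomial_subset_rootSet` — finiteness bookkeeping ("`N` large"). [folklore]
* `exists_finset_valueSubgroup_le`, `exists_finset_residueSubfield_le`,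
  `exists_finset_finrank_adjoin_le`, `exists_finset_injOn_comap` — the four exhaustion lemmas
  (values, residues, degrees, separation of extensions). [folklore]
* `exists_isDefectlessIn_adjoin_rootSet` — **the limit step** above.

## Sources

* F.-V. Kuhlmann, Trans. AMS 362 (2010) = arXiv:1003.5678, §2.4, Cor. 2.25 and its proof (p. 8);
  the limit argument is that of F.-V. Kuhlmann, *A classification of Artin–Schreier defect
  extensions and characterizations of defectless fields*, Illinois J. Math. 54 (2010), Lemma 2.3,
  cited there.
-/

noncomputable section

open IsLocalRing Polynomial

namespace Literature.AlgebraicGeometry.Resolution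

universe u

/-! ### Finiteness bookkeeping -/

section Finite

variable {K F Ω : Type u} [Field K] [Field F] [Field Ω] [Algebra F Ω] [Algebra K Ω]

/-- An element of `F(A ∪ T)` lies in `F(S ∪ T)` for a finite `S ⊆ A`. [folklore] -/
theorem exists_finset_subset_mem_adjoin (A T : Set Ω) {z : Ω}
    (hz : z ∈ IntermediateField.adjoin F (A ∪ T)) :
    ∃ S : Finset Ω, (↑S : Set Ω) ⊆ A ∧ z ∈ IntermediateField.adjoin F (↑S ∪ T) := by
  classical
  obtain ⟨S₀, hS₀, hzS₀⟩ := IntermediateField.exists_finset_of_mem_adjoin hz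
  refine ⟨S₀.filter (· ∈ A), fun x hx => (Finset.mem_filter.mp hx).2, ?_⟩
  refine IntermediateField.adjoin.mono F _ _ (fun x hx => ?_) hzS₀
  rcases hS₀ hx with hA | hT
  · exact Or.inl (Finset.mem_filter.mpr ⟨hx, hA⟩)
  · exact Or.inr hT

/-- If `S ⊆ E` for an intermediate field `E`, then `F(S ∪ T) ⊆ E(T)`. [folklore] -/
theorem mem_adjoin_adjoin_of_subset (E : IntermediateField F Ω) (S : Set Ω) (T : Set Ω)
    (hS : S ⊆ (E : Set Ω)) {z : Ω} (hz : z ∈ IntermediateField.adjoin F (S ∪ T)) :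
    z ∈ IntermediateField.adjoin E T := by
  have hle : IntermediateField.adjoin F (S ∪ T) ≤
      (IntermediateField.adjoin E T).restrictScalars F := by
    refine IntermediateField.adjoin_le_iff.mpr ?_
    rintro x (hx | hx)
    · rw [SetLike.mem_coe, IntermediateField.mem_restrictScalars]
      exact IntermediateField.adjoin.range_algebraMap_subset _ _ ⟨⟨x, hS hx⟩, rfl⟩
    · rw [SetLike.mem_coe, IntermediateField.mem_restrictScalars]
      exact IntermediateField.subset_adjoin _ _ hx
  exact hle hz

/-- A finite set of elements algebraic over `K` consists of roots of one non-zero polynomial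
over `K` (the product of the minimal polynomials). [folklore] -/
theorem exists_polynomial_subset_rootSet (U : Finset Ω)
    (hU : ∀ a ∈ U, a ∈ algebraicClosure K Ω) :
    ∃ p : K[X], (↑U : Set Ω) ⊆ p.rootSet Ω := by
  classical
  have hint : ∀ b ∈ U, IsIntegral K b := fun b hb =>
    ((mem_algebraicClosure_iff (F := K)).mp (hU b hb)).isIntegral
  refine ⟨∏ a ∈ U, minpoly K a, fun a ha => ?_⟩
  have ha' : a ∈ U := Finset.mem_coe.mp ha
  have hne : (∏ b ∈ U, minpoly K b) ≠ 0 :=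
    Finset.prod_ne_zero_iff.mpr fun b hb => minpoly.ne_zero (hint b hb)
  rw [Polynomial.mem_rootSet]
  refine ⟨hne, ?_⟩
  rw [map_prod]
  exact Finset.prod_eq_zero ha' (minpoly.aeval K a)

end Finite

/-! ### The four exhaustion lemmas -/

section Exhaust

variable {Ω : Type u} [Field Ω] (V : ValuationSubring Ω)

/-- **Values**: if `(vB : vA)` is finite, finitely many elements of `B` represent `vB` modulo
`vA`; any field `E ⊆ Ω` containing them has `vB ⊆ vE·vA`. [folklore] -/
theorem exists_finset_valueSubgroup_le {A B : Type u} [Field A] [Field B] [Algebra A Ω]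
    [Algebra B Ω] (hfin : (valueSubgroup A V).relIndex (valueSubgroup B V) ≠ 0) :
    ∃ X : Finset Ω, (↑X : Set Ω) ⊆ Set.range (algebraMap B Ω) ∧
      ∀ (E : Type u) [Field E] [Algebra E Ω], (↑X : Set Ω) ⊆ Set.range (algebraMap E Ω) →
        valueSubgroup B V ≤ valueSubgroup E V ⊔ valueSubgroup A V := by
  classical
  set G := valueSubgroup B V with hG
  set H := valueSubgroup A V with hH
  haveI : (H.subgroupOf G).FiniteIndex := ⟨hfin⟩
  haveI : Finite (G ⧸ H.subgroupOf G) := Subgroup.finite_quotient_of_finiteIndex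
  letI : Fintype (G ⧸ H.subgroupOf G) := Fintype.ofFinite _
  -- representatives
  have hrep : ∀ q : G ⧸ H.subgroupOf G, ∃ x : B, x ≠ 0 ∧
      (((Quotient.out q : G) : (V.ValueGroup)ˣ) : V.ValueGroup) = V.valuation (algebraMap B Ω x) :=
    fun q => (mem_valueSubgroup_iff B V _).mp (Quotient.out q).2
  choose x hx0 hxv using hrep
  refine ⟨Finset.univ.image fun q => algebraMap B Ω (x q), ?_, ?_⟩
  · intro y hy
    obtain ⟨q, -, rfl⟩ := Finset.mem_image.mp (Finset.mem_coe.mp hy)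
    exact ⟨x q, rfl⟩
  · intro E _ _ hXE γ hγ
    set g : G := ⟨γ, hγ⟩ with hg
    obtain ⟨h, hh⟩ := QuotientGroup.mk_out_eq_mul (H.subgroupOf G) g
    -- `γ = out(q) · h⁻¹`
    have hγeq : γ = ((Quotient.out (QuotientGroup.mk g : G ⧸ H.subgroupOf G) : G) : (V.ValueGroup)ˣ) *
        ((h⁻¹ : H.subgroupOf G) : G) := by
      rw [hh]
      simp [hg]
    rw [hγeq]
    refine Subgroup.mul_mem_sup ?_ ?_
    · -- the representative is the value of an element of `E`
      set q := (QuotientGroup.mk g : G ⧸ H.subgroupOf G) with hq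
      have hmem : algebraMap B Ω (x q) ∈ (↑(Finset.univ.image fun q => algebraMap B Ω (x q)) : Set Ω) :=
        Finset.mem_coe.mpr (Finset.mem_image.mpr ⟨q, Finset.mem_univ _, rfl⟩)
      obtain ⟨e, he⟩ := hXE hmem
      refine (mem_valueSubgroup_iff E V _).mpr ⟨e, ?_, ?_⟩
      · rintro rfl
        rw [map_zero] at he
        exact hx0 q ((map_eq_zero _).mp he.symm)
      · rw [he]; exact hxv q
    · exact (Subgroup.mem_subgroupOf.mp (h⁻¹).2)

/-- **Residues**: if `Av ⊆ Bv` has finite degree, finitely many elements of `B` lift an `Av`-basis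
of `Bv`; any field `E ⊆ Ω` containing them has `Bv ⊆ Av·Ev`. [folklore] -/
theorem exists_finset_residueSubfield_le {A B : Type u} [Field A] [Field B] [Algebra A Ω]
    [Algebra B Ω] (hle : residueSubfield A V ≤ residueSubfield B V)
    (hfin : (residueSubfield A V).relfinrank (residueSubfield B V) ≠ 0) :
    ∃ X : Finset Ω, (↑X : Set Ω) ⊆ Set.range (algebraMap B Ω) ∧
      ∀ (E : Type u) [Field E] [Algebra E Ω], (↑X : Set Ω) ⊆ Set.range (algebraMap E Ω) →
        residueSubfield B V ≤ residueSubfield A V ⊔ residueSubfield E V := by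
  classical
  set RA := residueSubfield A V with hRA
  set RB := residueSubfield B V with hRB
  set T := Subfield.extendScalars hle with hT
  haveI : Module.Finite RA T := by
    rw [Subfield.relfinrank_eq_finrank_of_le hle] at hfin
    exact Module.finite_of_finrank_pos (Nat.pos_of_ne_zero hfin)
  let b := Module.finBasis RA T
  -- lifts of the basis
  have hlift : ∀ i, ∃ (y : B) (h : algebraMap B Ω y ∈ V),
      residue V ⟨algebraMap B Ω y, h⟩ = ((b i : T) : ResidueField V) := fun i =>
    (mem_residueSubfield_iff B V _).mp (b i).2
  choose y hyV hyres using hlift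
  refine ⟨Finset.univ.image fun i => algebraMap B Ω (y i), ?_, ?_⟩
  · intro z hz
    obtain ⟨i, -, rfl⟩ := Finset.mem_image.mp (Finset.mem_coe.mp hz)
    exact ⟨y i, rfl⟩
  · intro E _ _ hXE ρ hρ
    set ρ' : T := ⟨ρ, hρ⟩ with hρ'
    have hsum : ρ = ∑ i, (((b.repr ρ' i : RA) : ResidueField V) * ((b i : T) : ResidueField V)) := by
      have h := congrArg (fun t : T => (t : ResidueField V)) (b.sum_repr ρ')
      simp only [AddSubmonoidClass.coe_finsetSum] at h
      calc ρ = (ρ' : ResidueField V) := rfl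
        _ = ∑ i, (((b.repr ρ' i) • b i : T) : ResidueField V) := h.symm
        _ = _ := Finset.sum_congr rfl fun i _ => rfl
    rw [hsum]
    refine Subfield.sum_mem _ fun i _ => Subfield.mul_mem _ ?_ ?_
    · exact (le_sup_left : RA ≤ RA ⊔ residueSubfield E V) (b.repr ρ' i).2
    · refine (le_sup_right : residueSubfield E V ≤ RA ⊔ residueSubfield E V) ?_
      have hmem : algebraMap B Ω (y i) ∈ (↑(Finset.univ.image fun i => algebraMap B Ω (y i)) : Set Ω) :=
        Finset.mem_coe.mpr (Finset.mem_image.mpr ⟨i, Finset.mem_univ _, rfl⟩)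
      obtain ⟨e, he⟩ := hXE hmem
      rw [← hyres i]
      refine (mem_residueSubfield_iff E V _).mpr ⟨e, by rw [he]; exact hyV i, ?_⟩
      congr 1
      exact Subtype.ext he

variable {F : Type u} [Field F] [Algebra F Ω] [IsAlgClosed Ω]

omit [IsAlgClosed Ω] in
/-- `F(roots of r) ⊆ A(roots of r)` and `A(roots of r) = A(F(roots of r))`. [folklore] -/
theorem adjoin_rootSet_eq_adjoin_adjoin (A : IntermediateField F Ω) (r : F[X]) :
    IntermediateField.adjoin A (r.rootSet Ω) =
      IntermediateField.adjoin A ((IntermediateField.adjoin F (r.rootSet Ω) : IntermediateField F Ω) : Set Ω) := by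
  apply le_antisymm
  · exact IntermediateField.adjoin.mono _ _ _ (IntermediateField.subset_adjoin F _)
  · refine IntermediateField.adjoin_le_iff.mpr ?_
    have : IntermediateField.adjoin F (r.rootSet Ω) ≤
        (IntermediateField.adjoin A (r.rootSet Ω)).restrictScalars F :=
      IntermediateField.adjoin_le_iff.mpr (IntermediateField.subset_adjoin _ _)
    exact this

/-- **Degrees**: for `A₀ ⊆ Ω` over `F` and `r ∈ F[X]`, finitely many elements of `A₀` (the
coefficients of an `F`-basis of `L = F(roots of r)` in an `A₀`-basis of `A₀(roots of r)`) have the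
property that any `A ⊇ F` containing them satisfies `[A(roots of r) : A] ≤ [A₀(roots of r) : A₀]`
(`A(roots of r)` is the `A`-span of `L`). [folklore] -/
theorem exists_finset_finrank_adjoin_le (A₀ : IntermediateField F Ω) (r : F[X])
    [FiniteDimensional A₀ (IntermediateField.adjoin A₀ (r.rootSet Ω))] :
    ∃ Y : Finset Ω, (↑Y : Set Ω) ⊆ (A₀ : Set Ω) ∧
      ∀ A : IntermediateField F Ω, (↑Y : Set Ω) ⊆ (A : Set Ω) →
        Module.finrank A (IntermediateField.adjoin A (r.rootSet Ω)) ≤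
          Module.finrank A₀ (IntermediateField.adjoin A₀ (r.rootSet Ω)) := by
  classical
  set L : IntermediateField F Ω := IntermediateField.adjoin F (r.rootSet Ω) with hL
  haveI : FiniteDimensional F L := finiteDimensional_adjoin_rootSet (Ω := Ω) r
  set E₀ := IntermediateField.adjoin A₀ (r.rootSet Ω) with hE₀
  set d := Module.finrank A₀ E₀ with hd
  let c := Module.finBasis A₀ E₀
  let bL := Module.finBasis F L
  have hLE₀ : (L : Set Ω) ⊆ (E₀ : Set Ω) := by
    rw [hE₀, adjoin_rootSet_eq_adjoin_adjoin]
    exact IntermediateField.subset_adjoin _ _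
  let bE : Fin (Module.finrank F L) → E₀ := fun i => ⟨(bL i : Ω), hLE₀ (bL i).2⟩
  -- the coefficients
  let m : Fin (Module.finrank F L) → Fin d → A₀ := fun i j => c.repr (bE i) j
  refine ⟨Finset.univ.image fun ij : Fin (Module.finrank F L) × Fin d => ((m ij.1 ij.2 : A₀) : Ω),
    ?_, ?_⟩
  · intro z hz
    obtain ⟨ij, -, rfl⟩ := Finset.mem_image.mp (Finset.mem_coe.mp hz)
    exact (m ij.1 ij.2).2
  · intro A hYA
    set E := IntermediateField.adjoin A (r.rootSet Ω) with hE
    -- the `A`-span of the `cⱼ`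
    set Sp : Submodule A Ω := Submodule.span A (Set.range fun j : Fin d => ((c j : E₀) : Ω)) with hSp
    -- each `bL i` lies in `Sp`
    have hbSp : ∀ i, (bL i : Ω) ∈ Sp := by
      intro i
      have h := congrArg (fun t : E₀ => (t : Ω)) (c.sum_repr (bE i))
      simp only [AddSubmonoidClass.coe_finsetSum] at h
      have hbi : (bL i : Ω) = ∑ j, ((m i j : A₀) : Ω) * ((c j : E₀) : Ω) := by
        rw [show (bL i : Ω) = (bE i : Ω) from rfl, ← h]; rfl
      rw [hbi]
      refine Submodule.sum_mem _ fun j _ => ?_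
      have hmA : ((m i j : A₀) : Ω) ∈ (A : Set Ω) :=
        hYA (Finset.mem_coe.mpr (Finset.mem_image.mpr ⟨(i, j), Finset.mem_univ _, rfl⟩))
      have : ((m i j : A₀) : Ω) * ((c j : E₀) : Ω) = (⟨_, hmA⟩ : A) • ((c j : E₀) : Ω) := rfl
      rw [this]
      exact Submodule.smul_mem _ _ (Submodule.subset_span ⟨j, rfl⟩)
    -- hence `L ⊆ Sp`
    have hLSp : (L : Set Ω) ⊆ Sp := by
      intro x hx
      have h := congrArg (fun t : L => (t : Ω)) (bL.sum_repr ⟨x, hx⟩)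
      simp only [AddSubmonoidClass.coe_finsetSum] at h
      have hx' : x = ∑ i, (bL.repr ⟨x, hx⟩ i) • (bL i : Ω) :=
        calc x = ∑ i, (((bL.repr ⟨x, hx⟩ i) • bL i : L) : Ω) := h.symm
          _ = _ := Finset.sum_congr rfl fun i _ => rfl
      rw [hx']
      refine Submodule.sum_mem _ fun i _ => ?_
      have : (bL.repr ⟨x, hx⟩ i) • (bL i : Ω) = (algebraMap F A (bL.repr ⟨x, hx⟩ i)) • (bL i : Ω) :=
        (algebraMap_smul A _ _).symm
      rw [this]
      exact Submodule.smul_mem _ _ (hbSp i)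
    -- `E = A(L)` is the `A`-span of `L`
    have halg : ∀ x ∈ (L : Set Ω), IsAlgebraic A x := fun x hx => by
      have h1 : IsAlgebraic F (⟨x, hx⟩ : L) := Algebra.IsAlgebraic.isAlgebraic _
      have h2 : IsAlgebraic F x := IntermediateField.isAlgebraic_iff.mp h1
      exact h2.tower_top A
    have hEsub : Subalgebra.toSubmodule E.toSubalgebra ≤ Sp := by
      rw [hE, adjoin_rootSet_eq_adjoin_adjoin, IntermediateField.adjoin_toSubalgebra_of_isAlgebraic halg,
        Algebra.adjoin_eq_span]
      refine Submodule.span_le.mpr ?_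
      have hcl : (Submonoid.closure (L : Set Ω) : Set Ω) = (L : Set Ω) := by
        have : Submonoid.closure (L : Set Ω) = L.toSubalgebra.toSubsemiring.toSubmonoid :=
          Submonoid.closure_eq _
        rw [this]; rfl
      rw [hcl]
      exact hLSp
    haveI : Module.Finite A Sp := FiniteDimensional.span_of_finite A (Set.finite_range _)
    calc Module.finrank A E = Module.finrank A (Subalgebra.toSubmodule E.toSubalgebra) := by
          rw [Subalgebra.finrank_toSubmodule, IntermediateField.finrank_eq_finrank_subalgebra]
      _ ≤ Module.finrank A Sp := Submodule.finrank_mono hEsub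
      _ ≤ Fintype.card (Fin d) := finrank_range_le_card _
      _ = d := Fintype.card_fin d

omit [IsAlgClosed Ω] in
/-- **Separation of extensions**: finitely many elements of `B` separate the members of a finite
set `s` of valuation rings of `B`; restriction to any subfield `E → B` containing them is
injective on `s`. [folklore] -/
theorem exists_finset_injOn_comap {B : Type u} [Field B] [Algebra B Ω]
    (s : Finset (ValuationSubring B)) :
    ∃ X : Finset Ω, (↑X : Set Ω) ⊆ Set.range (algebraMap B Ω) ∧
      ∀ (E : Type u) [Field E] (ι : E →+* B),
        (↑X : Set Ω) ⊆ Set.range ((algebraMap B Ω).comp ι) →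
        Set.InjOn (fun W : ValuationSubring B => W.comap ι) ↑s := by
  classical
  have hsep : ∀ P : ValuationSubring B × ValuationSubring B, P.1 ≠ P.2 →
      ∃ z : B, ¬ (z ∈ P.1 ↔ z ∈ P.2) := by
    intro P hP
    by_contra h
    push Not at h
    exact hP (SetLike.ext h)
  let z : ValuationSubring B × ValuationSubring B → B := fun P =>
    if hP : P.1 ≠ P.2 then Classical.choose (hsep P hP) else 0
  have hz : ∀ P : ValuationSubring B × ValuationSubring B, P.1 ≠ P.2 → ¬ (z P ∈ P.1 ↔ z P ∈ P.2) := by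
    intro P hP
    simp only [z, dif_pos hP]
    exact Classical.choose_spec (hsep P hP)
  refine ⟨(s ×ˢ s).image fun P => algebraMap B Ω (z P), ?_, ?_⟩
  · intro y hy
    obtain ⟨P, -, rfl⟩ := Finset.mem_image.mp (Finset.mem_coe.mp hy)
    exact ⟨z P, rfl⟩
  · intro E _ ι hXE W hW W' hW' heq
    by_contra hne
    have hmem : algebraMap B Ω (z (W, W')) ∈
        (↑((s ×ˢ s).image fun P => algebraMap B Ω (z P)) : Set Ω) :=
      Finset.mem_coe.mpr (Finset.mem_image.mpr ⟨(W, W'), Finset.mem_product.mpr ⟨hW, hW'⟩, rfl⟩)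
    obtain ⟨e, he⟩ := hXE hmem
    have hze : z (W, W') = ι e := (algebraMap B Ω).injective (by rw [← he]; rfl)
    apply hz (W, W') hne
    change z (W, W') ∈ W ↔ z (W, W') ∈ W'
    rw [hze, ← ValuationSubring.mem_comap, ← ValuationSubring.mem_comap]
    change e ∈ (fun W : ValuationSubring B => W.comap ι) W ↔ e ∈ (fun W : ValuationSubring B => W.comap ι) W'
    rw [heq]

end Exhaust

/-! ### Abstract counting -/

section Count

variable {Ω : Type u} [Field Ω] (V : ValuationSubring Ω)

/-- **Counting criterion for defectlessness over a finite normal extension**: if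
`[B : A] ≤ n ≤ g · e(V ∩ B / A) f(V ∩ B / A)` where `g` is the number of extensions of `V ∩ A` to
`B`, then `(A, V ∩ A)` is defectless in `B` (all extensions are conjugate, so `∑ e f = g e f`, and
the fundamental inequality gives `g e f ≤ [B : A]`). [folklore] -/
theorem isDefectlessIn_of_le_card_mul {A B : Type u} [Field A] [Field B] [Algebra A B] [Algebra B Ω]
    [Algebra A Ω] [IsScalarTower A B Ω] [FiniteDimensional A B] [Normal A B] (n : ℕ)
    (hn : Module.finrank A B ≤ n)
    (h : ∀ s : Finset (ValuationSubring B),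
      (∀ W, W ∈ s ↔ W.comap (algebraMap A B) = V.comap (algebraMap A Ω)) →
      n ≤ s.card * (ramificationIndex A (V.comap (algebraMap B Ω)) *
        inertiaDegree A (V.comap (algebraMap B Ω)))) :
    IsDefectlessIn A (V.comap (algebraMap A Ω)) B := by
  classical
  have hW : (V.comap (algebraMap B Ω)).comap (algebraMap A B) = V.comap (algebraMap A Ω) := by
    ext a
    rw [ValuationSubring.mem_comap, ValuationSubring.mem_comap, ValuationSubring.mem_comap,
      ← IsScalarTower.algebraMap_apply]
  obtain ⟨s, hs, hle⟩ := FundamentalInequality_holds A B inferInstance (V.comap (algebraMap A Ω))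
  have hsum : ∑ W ∈ s, ramificationIndex A W * inertiaDegree A W =
      s.card * (ramificationIndex A (V.comap (algebraMap B Ω)) *
        inertiaDegree A (V.comap (algebraMap B Ω))) :=
    sum_ramificationIndex_mul_inertiaDegree_eq_card_mul _ s _ fun W' => by rw [hs, hW]
  refine ⟨s, hs, le_antisymm hle ?_⟩
  rw [hsum]
  exact hn.trans (h s hs)

/-- **Restriction of extensions along a square** `A → B`, `A' → B'` of subfields of `Ω` with
`A ⊆ A'` and `ι : B → B'` over `Ω`: if restriction along `ι` is injective on a set `s'` of
extensions of `V ∩ A'` to `B'`, then `s'` has at most as many elements as the set `s` of all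
extensions of `V ∩ A` to `B`. [folklore] -/
theorem card_le_card_of_injOn_comap {A B A' B' : Type u} [Field A] [Field B] [Field A'] [Field B']
    [Algebra A B] [Algebra B Ω] [Algebra A Ω] [IsScalarTower A B Ω]
    [Algebra A' B'] [Algebra B' Ω] [Algebra A' Ω] [IsScalarTower A' B' Ω]
    (hAA' : Set.range (algebraMap A Ω) ⊆ Set.range (algebraMap A' Ω))
    (ι : B →+* B') (hι : ∀ x, algebraMap B' Ω (ι x) = algebraMap B Ω x)
    (s' : Finset (ValuationSubring B'))
    (hs' : ∀ W, W ∈ s' → W.comap (algebraMap A' B') = V.comap (algebraMap A' Ω))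
    (hinj : Set.InjOn (fun W : ValuationSubring B' => W.comap ι) ↑s')
    (s : Finset (ValuationSubring B))
    (hs : ∀ W, W.comap (algebraMap A B) = V.comap (algebraMap A Ω) → W ∈ s) :
    s'.card ≤ s.card := by
  refine Finset.card_le_card_of_injOn (fun W : ValuationSubring B' => W.comap ι) ?_ hinj
  intro W hW
  refine Finset.mem_coe.mpr (hs _ ?_)
  ext a
  obtain ⟨a', ha'⟩ := hAA' ⟨a, rfl⟩
  have hιa : ι (algebraMap A B a) = algebraMap A' B' a' := (algebraMap B' Ω).injective (by
    rw [hι, ← IsScalarTower.algebraMap_apply, ← IsScalarTower.algebraMap_apply, ha'])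
  rw [ValuationSubring.mem_comap, ValuationSubring.mem_comap, hιa, ← ValuationSubring.mem_comap,
    hs' W (Finset.mem_coe.mp hW), ValuationSubring.mem_comap, ValuationSubring.mem_comap, ha']

/-- **Relative indices at a finite level**: if `G' = H ⊔ G` (the values of the big field are
generated by those of the small field and of the base) and `H₀ ≤ G ⊓ H` with `(H : H₀)` finite,
then `(G' : G) ≤ (H : H₀)`. [folklore] -/
theorem relIndex_le_of_eq_sup {Γ : Type*} [CommGroup Γ] {G G' H H₀ : Subgroup Γ}
    (hsup : G' = H ⊔ G) (hH₀ : H₀ ≤ G ⊓ H) (hfin : H₀.relIndex H ≠ 0) :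
    G.relIndex G' ≤ H₀.relIndex H := by
  rw [hsup, Subgroup.relIndex_sup_right, ← Subgroup.inf_relIndex_right]
  exact Subgroup.relIndex_le_of_le_left hH₀ hfin

end Count

/-! ### The limit step -/

section Limit

variable {K F Ω : Type u} [Field K] [Field F] [Field Ω] [Algebra F Ω] [Algebra K Ω]
  [IsAlgClosed Ω] (V : ValuationSubring Ω) (r : F[X])

omit [IsAlgClosed Ω] in
/-- The roots of `p ∈ K[X]` are algebraic over `K`: `F(roots of p) ⊆ M = F(K̃)`. [folklore] -/
theorem adjoin_rootSet_le_adjoin_algebraicClosure (p : K[X]) : (IntermediateField.adjoin F ((p).rootSet Ω) : IntermediateField F Ω) ≤ (IntermediateField.adjoin F ((algebraicClosure K Ω : IntermediateField K Ω) : Set Ω) : IntermediateField F Ω) := by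
  refine IntermediateField.adjoin.mono F _ _ fun a ha => ?_
  rw [Polynomial.mem_rootSet] at ha
  exact mem_algebraicClosure_iff.mpr ⟨p, ha.1, ha.2⟩

omit [Algebra K Ω] [IsAlgClosed Ω] in
/-- `A(roots of r) ⊆ B(roots of r)` for `A ≤ B`. [folklore] -/
theorem adjoin_rootSet_subset_of_le {A B : IntermediateField F Ω} (h : A ≤ B) :
    ((IntermediateField.adjoin A (r.rootSet Ω) : IntermediateField A Ω) : Set Ω) ⊆
      ((IntermediateField.adjoin B (r.rootSet Ω) : IntermediateField B Ω) : Set Ω) := by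
  have h1 : (IntermediateField.adjoin A (r.rootSet Ω)).restrictScalars F ≤
      (IntermediateField.adjoin B (r.rootSet Ω)).restrictScalars F := by
    rw [IntermediateField.restrictScalars_adjoin, IntermediateField.restrictScalars_adjoin]
    exact IntermediateField.adjoin.mono F _ _
      (Set.union_subset_union_left _ (SetLike.coe_subset_coe.mpr h))
  exact fun x hx => h1 hx

omit [IsAlgClosed Ω] in
/-- **`N` large**: finitely many elements of `L·M = M(roots of r)` and of `M = F(K̃)` lie in
`L₁ = F₁(roots of r)` and `F₁ = F(roots of p)` respectively, for a suitable `p ∈ K[X]` (each of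
them involves finitely many elements of `K̃`, which are roots of one polynomial over `K`).
[folklore] -/
theorem exists_polynomial_finsets_subset (X Y : Finset Ω)
    (hX : (↑X : Set Ω) ⊆ ((IntermediateField.adjoin (IntermediateField.adjoin F ((algebraicClosure K Ω : IntermediateField K Ω) : Set Ω) : IntermediateField F Ω) (r.rootSet Ω) : IntermediateField (IntermediateField.adjoin F ((algebraicClosure K Ω : IntermediateField K Ω) : Set Ω) : IntermediateField F Ω) Ω) : Set Ω))
    (hY : (↑Y : Set Ω) ⊆ ((IntermediateField.adjoin F ((algebraicClosure K Ω : IntermediateField K Ω) : Set Ω) : IntermediateField F Ω) : Set Ω)) :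
    ∃ p : K[X], (↑X : Set Ω) ⊆ ((IntermediateField.adjoin (IntermediateField.adjoin F ((p).rootSet Ω) : IntermediateField F Ω) (r.rootSet Ω) :
        IntermediateField (IntermediateField.adjoin F ((p).rootSet Ω) : IntermediateField F Ω) Ω) : Set Ω) ∧ (↑Y : Set Ω) ⊆ ((IntermediateField.adjoin F ((p).rootSet Ω) : IntermediateField F Ω) : Set Ω) := by
  classical
  -- every element of `L·M` lies in `F(S ∪ roots of r)`, every element of `M` in `F(S)`, for a
  -- finite `S ⊆ K̃`
  have hsuppLM : ∀ z : Ω, z ∈ ((IntermediateField.adjoin (IntermediateField.adjoin F ((algebraicClosure K Ω : IntermediateField K Ω) : Set Ω) : IntermediateField F Ω) (r.rootSet Ω) :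
      IntermediateField (IntermediateField.adjoin F ((algebraicClosure K Ω : IntermediateField K Ω) : Set Ω) : IntermediateField F Ω) Ω) : Set Ω) → ∃ S : Finset Ω,
      (↑S : Set Ω) ⊆ ((algebraicClosure K Ω : IntermediateField K Ω) : Set Ω) ∧
      z ∈ IntermediateField.adjoin F (↑S ∪ r.rootSet Ω) := by
    intro z hz
    have hz' : z ∈ (IntermediateField.adjoin (IntermediateField.adjoin F ((algebraicClosure K Ω : IntermediateField K Ω) : Set Ω) : IntermediateField F Ω) (r.rootSet Ω)).restrictScalars F := hz
    rw [IntermediateField.adjoin_adjoin_left] at hz'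
    exact exists_finset_subset_mem_adjoin _ _ hz'
  have hsuppM : ∀ z : Ω, z ∈ ((IntermediateField.adjoin F ((algebraicClosure K Ω : IntermediateField K Ω) : Set Ω) : IntermediateField F Ω) : Set Ω) → ∃ S : Finset Ω,
      (↑S : Set Ω) ⊆ ((algebraicClosure K Ω : IntermediateField K Ω) : Set Ω) ∧
      z ∈ IntermediateField.adjoin F (↑S : Set Ω) := fun z hz =>
    IntermediateField.exists_finset_of_mem_adjoin hz
  choose suppLM hsuppLMK hsuppLMmem using hsuppLM
  choose suppM hsuppMK hsuppMmem using hsuppM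
  set U : Finset Ω := (X.attach.biUnion fun x => suppLM x.1 (hX x.2)) ∪
    (Y.attach.biUnion fun y => suppM y.1 (hY y.2)) with hUdef
  have hUK : ∀ a ∈ U, a ∈ algebraicClosure K Ω := by
    intro a ha
    rcases Finset.mem_union.mp ha with ha | ha
    · obtain ⟨x, -, hax⟩ := Finset.mem_biUnion.mp ha
      exact hsuppLMK x.1 (hX x.2) hax
    · obtain ⟨y, -, hay⟩ := Finset.mem_biUnion.mp ha
      exact hsuppMK y.1 (hY y.2) hay
  obtain ⟨p, hpU⟩ := exists_polynomial_subset_rootSet U hUK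
  have hUF₁ : (↑U : Set Ω) ⊆ ((IntermediateField.adjoin F ((p).rootSet Ω) : IntermediateField F Ω) : Set Ω) :=
    hpU.trans (IntermediateField.subset_adjoin F _)
  refine ⟨p, fun x hx => ?_, fun y hy => ?_⟩
  · have hx' : x ∈ X := Finset.mem_coe.mp hx
    have hsub : (↑(suppLM x (hX hx)) : Set Ω) ⊆ ((IntermediateField.adjoin F ((p).rootSet Ω) : IntermediateField F Ω) : Set Ω) :=
      fun a ha => hUF₁ (Finset.mem_coe.mpr (Finset.mem_union_left _
        (Finset.mem_biUnion.mpr ⟨⟨x, hx'⟩, Finset.mem_attach _ _, Finset.mem_coe.mp ha⟩)))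
    exact mem_adjoin_adjoin_of_subset (IntermediateField.adjoin F ((p).rootSet Ω) : IntermediateField F Ω) _ _ hsub (hsuppLMmem x (hX hx))
  · have hy' : y ∈ Y := Finset.mem_coe.mp hy
    have hsub : (↑(suppM y (hY hy)) : Set Ω) ⊆ p.rootSet Ω := fun a ha =>
      hpU (Finset.mem_coe.mpr (Finset.mem_union_right _
        (Finset.mem_biUnion.mpr ⟨⟨y, hy'⟩, Finset.mem_attach _ _, Finset.mem_coe.mp ha⟩)))
    exact IntermediateField.adjoin.mono F _ _ hsub (hsuppMmem y (hY hy))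

/-- **Kuhlmann 2010, Cor. 2.25 at finite level, limit step**: let `K → Ω ← F` with `Ω`
algebraically closed and algebraic over `F`, `V` a valuation ring of `Ω`, `M = F(K̃)` the
compositum of `F` with the algebraic closure `K̃` of `K` in `Ω`, and `r ∈ F[X]`. If `(M, V ∩ M)` is
a defectless field, then there is `p ∈ K[X]` such that, with `F₁ = F(roots of p)` and
`L₁ = F₁(roots of r)`, `(F₁, V ∩ F₁)` is defectless in `L₁`. PROVED (see the module docstring:
`[L₁ : F₁] ≤ [L·M : M] = g e f (L·M/M) ≤ g e f (L₁/F₁) ≤ [L₁ : F₁]` for `N = K(roots of p)`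
large). [cite: Kuhlmann2010, Cor. 2.25] -/
theorem exists_isDefectlessIn_adjoin_rootSet [Algebra.IsAlgebraic F Ω]
    (hDM : IsDefectlessField (IntermediateField.adjoin F ((algebraicClosure K Ω : IntermediateField K Ω) : Set Ω) : IntermediateField F Ω) (V.comap (algebraMap (IntermediateField.adjoin F ((algebraicClosure K Ω : IntermediateField K Ω) : Set Ω) : IntermediateField F Ω) Ω))) :
    ∃ p : K[X], IsDefectlessIn ((IntermediateField.adjoin F ((p).rootSet Ω) : IntermediateField F Ω)) (V.comap (algebraMap (IntermediateField.adjoin F ((p).rootSet Ω) : IntermediateField F Ω) Ω))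
      (IntermediateField.adjoin (IntermediateField.adjoin F ((p).rootSet Ω) : IntermediateField F Ω) (r.rootSet Ω)) := by
  classical
  -- `L·M = M(roots of r)` is finite normal over `M`, which is defectless in it
  set LM := IntermediateField.adjoin (IntermediateField.adjoin F ((algebraicClosure K Ω : IntermediateField K Ω) : Set Ω) : IntermediateField F Ω) (r.rootSet Ω) with hLMdef
  haveI hLMfin : FiniteDimensional (IntermediateField.adjoin F ((algebraicClosure K Ω : IntermediateField K Ω) : Set Ω) : IntermediateField F Ω) LM := finiteDimensional_adjoin_rootSet_intermediateField (IntermediateField.adjoin F ((algebraicClosure K Ω : IntermediateField K Ω) : Set Ω) : IntermediateField F Ω) r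
  haveI hLMnor : Normal (IntermediateField.adjoin F ((algebraicClosure K Ω : IntermediateField K Ω) : Set Ω) : IntermediateField F Ω) LM := normal_adjoin_rootSet_intermediateField (IntermediateField.adjoin F ((algebraicClosure K Ω : IntermediateField K Ω) : Set Ω) : IntermediateField F Ω) r
  set WM : ValuationSubring (IntermediateField.adjoin F ((algebraicClosure K Ω : IntermediateField K Ω) : Set Ω) : IntermediateField F Ω) := V.comap (algebraMap (IntermediateField.adjoin F ((algebraicClosure K Ω : IntermediateField K Ω) : Set Ω) : IntermediateField F Ω) Ω) with hWMdef
  set WLM : ValuationSubring LM := V.comap (algebraMap LM Ω) with hWLMdef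
  have hWLM : WLM.comap (algebraMap (IntermediateField.adjoin F ((algebraicClosure K Ω : IntermediateField K Ω) : Set Ω) : IntermediateField F Ω) LM) = WM := by
    ext m
    rw [ValuationSubring.mem_comap, hWLMdef, ValuationSubring.mem_comap, hWMdef,
      ValuationSubring.mem_comap, ← IsScalarTower.algebraMap_apply]
  obtain ⟨sM, hsM, hsumM⟩ := hDM LM inferInstance
  have hsumM' : ∑ W ∈ sM, ramificationIndex (IntermediateField.adjoin F ((algebraicClosure K Ω : IntermediateField K Ω) : Set Ω) : IntermediateField F Ω) W * inertiaDegree (IntermediateField.adjoin F ((algebraicClosure K Ω : IntermediateField K Ω) : Set Ω) : IntermediateField F Ω) W =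
      sM.card * (ramificationIndex (IntermediateField.adjoin F ((algebraicClosure K Ω : IntermediateField K Ω) : Set Ω) : IntermediateField F Ω) WLM * inertiaDegree (IntermediateField.adjoin F ((algebraicClosure K Ω : IntermediateField K Ω) : Set Ω) : IntermediateField F Ω) WLM) :=
    sum_ramificationIndex_mul_inertiaDegree_eq_card_mul _ sM WLM fun W' => by rw [hsM, hWLM]
  obtain ⟨heM1, hfM1⟩ := one_le_ramificationIndex_and_inertiaDegree (IntermediateField.adjoin F ((algebraicClosure K Ω : IntermediateField K Ω) : Set Ω) : IntermediateField F Ω) WLM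
  have heM : ramificationIndex (IntermediateField.adjoin F ((algebraicClosure K Ω : IntermediateField K Ω) : Set Ω) : IntermediateField F Ω) WLM = (valueSubgroup (IntermediateField.adjoin F ((algebraicClosure K Ω : IntermediateField K Ω) : Set Ω) : IntermediateField F Ω) V).relIndex (valueSubgroup LM V) :=
    ramificationIndex_comap_eq_relIndex V _ _
  have hfM : inertiaDegree (IntermediateField.adjoin F ((algebraicClosure K Ω : IntermediateField K Ω) : Set Ω) : IntermediateField F Ω) WLM = (residueSubfield (IntermediateField.adjoin F ((algebraicClosure K Ω : IntermediateField K Ω) : Set Ω) : IntermediateField F Ω) V).relfinrank (residueSubfield LM V) :=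
    inertiaDegree_comap_eq_relfinrank V _ _
  have hrangeLM : Set.range (algebraMap LM Ω) = (LM : Set Ω) :=
    coe_range_algebraMap_intermediateField (Ω := Ω) LM
  have hrangeM : Set.range (algebraMap (IntermediateField.adjoin F ((algebraicClosure K Ω : IntermediateField K Ω) : Set Ω) : IntermediateField F Ω) Ω) = ((IntermediateField.adjoin F ((algebraicClosure K Ω : IntermediateField K Ω) : Set Ω) : IntermediateField F Ω) : Set Ω) :=
    coe_range_algebraMap_intermediateField (Ω := Ω) (IntermediateField.adjoin F ((algebraicClosure K Ω : IntermediateField K Ω) : Set Ω) : IntermediateField F Ω)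
  have hMLM : Set.range (algebraMap (IntermediateField.adjoin F ((algebraicClosure K Ω : IntermediateField K Ω) : Set Ω) : IntermediateField F Ω) Ω) ⊆ Set.range (algebraMap LM Ω) := by
    rintro _ ⟨m, rfl⟩; exact ⟨algebraMap (IntermediateField.adjoin F ((algebraicClosure K Ω : IntermediateField K Ω) : Set Ω) : IntermediateField F Ω) LM m, (IsScalarTower.algebraMap_apply _ _ _ m).symm⟩
  have hGle : valueSubgroup (IntermediateField.adjoin F ((algebraicClosure K Ω : IntermediateField K Ω) : Set Ω) : IntermediateField F Ω) V ≤ valueSubgroup LM V := valueSubgroup_le_of_range_subset V hMLM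
  have hRle : residueSubfield (IntermediateField.adjoin F ((algebraicClosure K Ω : IntermediateField K Ω) : Set Ω) : IntermediateField F Ω) V ≤ residueSubfield LM V := residueSubfield_le_of_range_subset V hMLM
  -- the four finite sets and the polynomial `p`
  obtain ⟨X₁, hX₁, hval⟩ := exists_finset_valueSubgroup_le V (A := (IntermediateField.adjoin F ((algebraicClosure K Ω : IntermediateField K Ω) : Set Ω) : IntermediateField F Ω)) (B := LM)
    (by rw [← heM]; exact Nat.one_le_iff_ne_zero.mp heM1)
  obtain ⟨X₂, hX₂, hres⟩ := exists_finset_residueSubfield_le V (A := (IntermediateField.adjoin F ((algebraicClosure K Ω : IntermediateField K Ω) : Set Ω) : IntermediateField F Ω)) (B := LM) hRle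
    (by rw [← hfM]; exact Nat.one_le_iff_ne_zero.mp hfM1)
  obtain ⟨Y, hY, hdeg⟩ := exists_finset_finrank_adjoin_le (IntermediateField.adjoin F ((algebraicClosure K Ω : IntermediateField K Ω) : Set Ω) : IntermediateField F Ω) r
  obtain ⟨X₄, hX₄, hsep⟩ := exists_finset_injOn_comap (Ω := Ω) (B := LM) sM
  have hXLM : (↑(X₁ ∪ X₂ ∪ X₄) : Set Ω) ⊆ (LM : Set Ω) := by
    rw [← hrangeLM, Finset.coe_union, Finset.coe_union]
    exact Set.union_subset (Set.union_subset hX₁ hX₂) hX₄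
  obtain ⟨p, hXL₁, hYF₁⟩ := exists_polynomial_finsets_subset r (X₁ ∪ X₂ ∪ X₄) Y hXLM hY
  refine ⟨p, ?_⟩
  -- `F₁ = F(roots of p)`, `L₁ = F₁(roots of r)`
  set F₁ : IntermediateField F Ω := (IntermediateField.adjoin F ((p).rootSet Ω) : IntermediateField F Ω) with hF₁def
  set L₁ := IntermediateField.adjoin F₁ (r.rootSet Ω) with hL₁def
  haveI hL₁fin : FiniteDimensional F₁ L₁ := finiteDimensional_adjoin_rootSet_intermediateField F₁ r
  haveI hL₁nor : Normal F₁ L₁ := normal_adjoin_rootSet_intermediateField F₁ r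
  have hF₁M : F₁ ≤ (IntermediateField.adjoin F ((algebraicClosure K Ω : IntermediateField K Ω) : Set Ω) : IntermediateField F Ω) := adjoin_rootSet_le_adjoin_algebraicClosure p
  have hL₁LM : (L₁ : Set Ω) ⊆ (LM : Set Ω) := adjoin_rootSet_subset_of_le r hF₁M
  have hrangeL₁ : Set.range (algebraMap L₁ Ω) = (L₁ : Set Ω) :=
    coe_range_algebraMap_intermediateField (Ω := Ω) L₁
  have hrangeF₁ : Set.range (algebraMap F₁ Ω) = ((F₁ : IntermediateField F Ω) : Set Ω) :=
    coe_range_algebraMap_intermediateField (Ω := Ω) F₁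
  have hXrange : ∀ Z : Finset Ω, Z ⊆ X₁ ∪ X₂ ∪ X₄ → (↑Z : Set Ω) ⊆ Set.range (algebraMap L₁ Ω) :=
    fun Z hZ z hz => by rw [hrangeL₁]; exact hXL₁ (Finset.coe_subset.mpr hZ hz)
  have hX₁X : X₁ ⊆ X₁ ∪ X₂ ∪ X₄ := (Finset.subset_union_left).trans Finset.subset_union_left
  have hX₂X : X₂ ⊆ X₁ ∪ X₂ ∪ X₄ := (Finset.subset_union_right).trans Finset.subset_union_left
  have hX₄X : X₄ ⊆ X₁ ∪ X₂ ∪ X₄ := Finset.subset_union_right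
  have hF₁Mrange : Set.range (algebraMap F₁ Ω) ⊆ Set.range (algebraMap (IntermediateField.adjoin F ((algebraicClosure K Ω : IntermediateField K Ω) : Set Ω) : IntermediateField F Ω) Ω) := by
    rw [hrangeF₁, hrangeM]; exact hF₁M
  have hF₁L₁range : Set.range (algebraMap F₁ Ω) ⊆ Set.range (algebraMap L₁ Ω) := by
    rintro _ ⟨x, rfl⟩; exact ⟨algebraMap F₁ L₁ x, (IsScalarTower.algebraMap_apply _ _ _ x).symm⟩
  have hL₁LMrange : Set.range (algebraMap L₁ Ω) ⊆ Set.range (algebraMap LM Ω) := by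
    rw [hrangeL₁, hrangeLM]; exact hL₁LM
  -- the valuation ring on `L₁`
  set WL₁ : ValuationSubring L₁ := V.comap (algebraMap L₁ Ω) with hWL₁def
  obtain ⟨he₁1, hf₁1⟩ := one_le_ramificationIndex_and_inertiaDegree F₁ WL₁
  have he₁ : ramificationIndex F₁ WL₁ = (valueSubgroup F₁ V).relIndex (valueSubgroup L₁ V) :=
    ramificationIndex_comap_eq_relIndex V _ _
  have hf₁ : inertiaDegree F₁ WL₁ = (residueSubfield F₁ V).relfinrank (residueSubfield L₁ V) :=
    inertiaDegree_comap_eq_relfinrank V _ _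
  -- (iii) `e(L₁/F₁) ≥ e(L·M/M)`
  have he : ramificationIndex (IntermediateField.adjoin F ((algebraicClosure K Ω : IntermediateField K Ω) : Set Ω) : IntermediateField F Ω) WLM ≤ ramificationIndex F₁ WL₁ := by
    rw [heM, he₁]
    refine relIndex_le_of_eq_sup (le_antisymm (hval L₁ (hXrange X₁ hX₁X))
      (sup_le (valueSubgroup_le_of_range_subset V hL₁LMrange) hGle))
      (le_inf (valueSubgroup_le_of_range_subset V hF₁Mrange)
        (valueSubgroup_le_of_range_subset V hF₁L₁range)) ?_
    rw [← he₁]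
    exact Nat.one_le_iff_ne_zero.mp he₁1
  -- (iv) `f(L₁/F₁) ≥ f(L·M/M)`
  have hf : inertiaDegree (IntermediateField.adjoin F ((algebraicClosure K Ω : IntermediateField K Ω) : Set Ω) : IntermediateField F Ω) WLM ≤ inertiaDegree F₁ WL₁ := by
    rw [hfM, hf₁]
    have hsup : residueSubfield LM V = residueSubfield (IntermediateField.adjoin F ((algebraicClosure K Ω : IntermediateField K Ω) : Set Ω) : IntermediateField F Ω) V ⊔ residueSubfield L₁ V :=
      le_antisymm (hres L₁ (hXrange X₂ hX₂X))
        (sup_le hRle (residueSubfield_le_of_range_subset V hL₁LMrange))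
    rw [hsup]
    refine relfinrank_sup_le_relfinrank (residueSubfield_le_of_range_subset V hF₁Mrange)
      (residueSubfield_le_of_range_subset V hF₁L₁range) ?_
    rw [← hf₁]
    exact Nat.one_le_iff_ne_zero.mp hf₁1
  -- the inclusion `ι : L₁ → L·M`
  have hleLM : L₁.restrictScalars F ≤ LM.restrictScalars F := fun x hx => hL₁LM hx
  let ι : L₁ →+* LM := (IntermediateField.inclusion hleLM).toRingHom
  have hι : ∀ x, algebraMap LM Ω (ι x) = algebraMap L₁ Ω x := fun x => by
    rw [IntermediateField.algebraMap_apply, IntermediateField.algebraMap_apply]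
    exact IntermediateField.coe_inclusion hleLM x
  -- counting: `[L₁ : F₁] ≤ [L·M : M] = g e f (L·M/M) ≤ g e f (L₁/F₁)`
  refine isDefectlessIn_of_le_card_mul V (Module.finrank (IntermediateField.adjoin F ((algebraicClosure K Ω : IntermediateField K Ω) : Set Ω) : IntermediateField F Ω) LM) (hdeg F₁ hYF₁) fun s₁ hs₁ => ?_
  have hcard : sM.card ≤ s₁.card :=
    card_le_card_of_injOn_comap V hF₁Mrange ι hι sM (fun W hW => (hsM W).mp hW)
      (hsep L₁ ι fun z hz => by
        obtain ⟨w, hw⟩ := hXrange X₄ hX₄X hz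
        exact ⟨w, by rw [RingHom.comp_apply, hι]; exact hw⟩)
      s₁ (fun W hW => (hs₁ W).mpr hW)
  rw [← hsumM, hsumM']
  exact Nat.mul_le_mul hcard (Nat.mul_le_mul he hf)

end Limit

end Literature.AlgebraicGeometry.Resolution
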